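import Literature.NumberTheory.DiophantineApproximation.DilogHermitePade
import Mathlib.NumberTheory.Chebyshev
import Mathlib.Algebra.Order.Field.Basic
import Mathlib.Data.Nat.Choose.Bounds
import HarnessLib

/-!
# Hermite–Padé forms for `1, Li₁, Li₂` at `1/N` — integrality and size of the coefficients

Topic `Literature/NumberTheory/DiophantineApproximation`. For the coefficients
`a_n = formA n N ∈ ℤ`, `b_n = formB n N`, `c_n = formC n N ∈ ℚ` of the type-I Hermite–Padé form
`S_n(1/N) = a_n Li₂(1/N) + b_n Li₁(1/N) + c_n` (vocabulary in `DilogHermitePade.lean`) we prove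

* integrality: `D_n · b_n ∈ ℤ` and `D_n · c_n ∈ ℤ` for the common denominator
  `D_n = denom n = lcm(1..3n) · lcm(1..n)²` (`isInt_denom_mul_formB`, `isInt_denom_mul_formC`),
  through `lcm(1..3n) · H_{n,i} ∈ ℤ` (`isInt_lcmUpto_mul_harm`);
* sizes: `A_{n,i} ≤ 2^{7n}`, `|H_{n,i}| ≤ 4n`, `|B_{n,i}| ≤ 4n · 2^{7n}` and
  `|a_n|, |b_n|, |c_n| ≤ 10 n³ 2^{7n} N^n` (`abs_formA_le`, `abs_formB_le`, `abs_formC_le`).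

Reference: S. David, N. Hirata-Kohno, M. Kawashima, *Can polylogarithms at algebraic points be
linearly independent?*, Moscow J. Comb. Number Th. 9 (2020), Thm 2.1.
-/

noncomputable section

open Finset

namespace Literature.NumberTheory.DiophantineApproximation

namespace DilogPade

/-! ### Sizes of the coefficients -/

/-- `A_{n,i} = C(2n+i,i) C(2n,n) C(n,i)² ≤ 2^{3n} · 2^{2n} · 2^{2n} = 2^{7n}` for `i ≤ n`.
[cite: DavidHirataKohnoKawashima2020, Thm 2.1] -/
theorem coefA_le {n i : ℕ} (hi : i ≤ n) : coefA n i ≤ 2 ^ (7 * n) := by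
  have h1 : (2 * n + i).choose i ≤ 2 ^ (3 * n) :=
    (Nat.choose_le_two_pow _ _).trans (Nat.pow_le_pow_right (by norm_num) (by omega))
  have h2 : (2 * n).choose n ≤ 2 ^ (2 * n) := Nat.choose_le_two_pow _ _
  have h3 : (n.choose i) ^ 2 ≤ 2 ^ (2 * n) := by
    calc (n.choose i) ^ 2 ≤ (2 ^ n) ^ 2 := Nat.pow_le_pow_left (Nat.choose_le_two_pow _ _) 2
      _ = 2 ^ (2 * n) := by rw [← pow_mul, mul_comm]
  calc coefA n i = (2 * n + i).choose i * (2 * n).choose n * (n.choose i) ^ 2 := rfl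
    _ ≤ 2 ^ (3 * n) * 2 ^ (2 * n) * 2 ^ (2 * n) := by gcongr
    _ = 2 ^ (7 * n) := by rw [← pow_add, ← pow_add]; ring_nf

/-- `|H_{n,i}| ≤ 2n + 2·n = 4n` for `i ≤ n`: `2n` terms `1/(i+j+1) ≤ 1` and `n` terms
`|1/(l−i)| ≤ 1`. [cite: DavidHirataKohnoKawashima2020, Thm 2.1] -/
theorem abs_harm_le {n i : ℕ} (hi : i ≤ n) : |harm n i| ≤ 4 * n := by
  have h1 : |∑ j ∈ range (2 * n), (1 : ℚ) / ((i : ℚ) + j + 1)| ≤ 2 * n := by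
    calc |∑ j ∈ range (2 * n), (1 : ℚ) / ((i : ℚ) + j + 1)|
        ≤ ∑ j ∈ range (2 * n), |(1 : ℚ) / ((i : ℚ) + j + 1)| := abs_sum_le_sum_abs _ _
      _ ≤ ∑ j ∈ range (2 * n), (1 : ℚ) := by
        refine sum_le_sum fun j _ => ?_
        rw [abs_of_pos (by positivity), div_le_one (by positivity)]
        have : (0 : ℚ) ≤ (i : ℚ) + j := by positivity
        linarith
      _ = 2 * n := by simp
  have h2 : |∑ l ∈ (range (n + 1)).filter (· ≠ i), (1 : ℚ) / ((l : ℚ) - i)| ≤ n := by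
    calc |∑ l ∈ (range (n + 1)).filter (· ≠ i), (1 : ℚ) / ((l : ℚ) - i)|
        ≤ ∑ l ∈ (range (n + 1)).filter (· ≠ i), |(1 : ℚ) / ((l : ℚ) - i)| :=
          abs_sum_le_sum_abs _ _
      _ ≤ ∑ l ∈ (range (n + 1)).filter (· ≠ i), (1 : ℚ) := by
        refine sum_le_sum fun l hl => ?_
        have hli : l ≠ i := (mem_filter.1 hl).2
        rw [abs_div, abs_one]
        rcases lt_or_gt_of_ne hli with h | h
        · have h' : (l : ℚ) + 1 ≤ i := by exact_mod_cast h
          rw [abs_of_neg (by linarith), div_le_one (by linarith)]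
          linarith
        · have h' : (i : ℚ) + 1 ≤ l := by exact_mod_cast h
          rw [abs_of_pos (by linarith), div_le_one (by linarith)]
          linarith
      _ = n := by
        rw [sum_const, filter_ne', card_erase_of_mem (by simp; omega), card_range]
        simp
  calc |harm n i| ≤ |∑ j ∈ range (2 * n), (1 : ℚ) / ((i : ℚ) + j + 1)| +
        |2 * ∑ l ∈ (range (n + 1)).filter (· ≠ i), (1 : ℚ) / ((l : ℚ) - i)| := abs_add_le _ _
    _ ≤ 2 * n + 2 * n := by
        rw [abs_mul, abs_two]
        linarith
    _ = 4 * n := by ring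

/-- `|B_{n,i}| = A_{n,i} |H_{n,i}| ≤ 4n · 2^{7n}` for `i ≤ n`.
[cite: DavidHirataKohnoKawashima2020, Thm 2.1] -/
theorem abs_coefB_le {n i : ℕ} (hi : i ≤ n) : |coefB n i| ≤ 4 * n * 2 ^ (7 * n) := by
  have hA : ((coefA n i : ℕ) : ℚ) ≤ 2 ^ (7 * n) := by exact_mod_cast coefA_le hi
  rw [coefB, abs_neg, abs_mul, Nat.abs_cast]
  calc (coefA n i : ℚ) * |harm n i| ≤ 2 ^ (7 * n) * (4 * n) :=
        mul_le_mul hA (abs_harm_le hi) (abs_nonneg _) (by positivity)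
    _ = 4 * n * 2 ^ (7 * n) := by ring

/-- `|a_n| ≤ (n+1) 2^{7n} N^n ≤ 10 n³ 2^{7n} N^n` for `n, N ≥ 1`.
[cite: DavidHirataKohnoKawashima2020, Thm 2.1] -/
theorem abs_formA_le {n N : ℕ} (hn : 1 ≤ n) (hN : 1 ≤ N) :
    |(formA n N : ℝ)| ≤ 10 * (n : ℝ) ^ 3 * 2 ^ (7 * n) * (N : ℝ) ^ n := by
  have hN' : (1 : ℝ) ≤ N := by exact_mod_cast hN
  have hn' : (1 : ℝ) ≤ n := by exact_mod_cast hn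
  have hterm : ∀ i ∈ range (n + 1),
      ((coefA n i : ℕ) : ℝ) * (N : ℝ) ^ i ≤ 2 ^ (7 * n) * (N : ℝ) ^ n := by
    intro i hi
    have hi' : i ≤ n := Nat.lt_succ_iff.1 (mem_range.1 hi)
    have hA : ((coefA n i : ℕ) : ℝ) ≤ 2 ^ (7 * n) := by exact_mod_cast coefA_le hi'
    exact mul_le_mul hA (pow_le_pow_right₀ hN' hi') (by positivity) (by positivity)
  have hcast : (formA n N : ℝ) = ∑ i ∈ range (n + 1), ((coefA n i : ℕ) : ℝ) * (N : ℝ) ^ i := by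
    push_cast [formA]
    rfl
  rw [hcast, abs_of_nonneg (sum_nonneg fun i _ => by positivity)]
  calc ∑ i ∈ range (n + 1), ((coefA n i : ℕ) : ℝ) * (N : ℝ) ^ i
      ≤ ∑ i ∈ range (n + 1), 2 ^ (7 * n) * (N : ℝ) ^ n := sum_le_sum hterm
    _ = ((n : ℝ) + 1) * (2 ^ (7 * n) * (N : ℝ) ^ n) := by simp
    _ ≤ 10 * (n : ℝ) ^ 3 * (2 ^ (7 * n) * (N : ℝ) ^ n) := by
        apply mul_le_mul_of_nonneg_right _ (by positivity)
        have hn2 : (n : ℝ) ≤ (n : ℝ) ^ 2 := by nlinarith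
        have hn3 : (n : ℝ) ^ 2 ≤ (n : ℝ) ^ 3 := by nlinarith
        nlinarith
    _ = 10 * (n : ℝ) ^ 3 * 2 ^ (7 * n) * (N : ℝ) ^ n := by ring

/-- `|b_n| ≤ (n+1) · 4n · 2^{7n} N^n ≤ 10 n³ 2^{7n} N^n` for `n, N ≥ 1`.
[cite: DavidHirataKohnoKawashima2020, Thm 2.1] -/
theorem abs_formB_le {n N : ℕ} (hn : 1 ≤ n) (hN : 1 ≤ N) :
    |((formB n N : ℚ) : ℝ)| ≤ 10 * (n : ℝ) ^ 3 * 2 ^ (7 * n) * (N : ℝ) ^ n := by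
  have key : |formB n N| ≤ 10 * (n : ℚ) ^ 3 * 2 ^ (7 * n) * (N : ℚ) ^ n := by
    have hN' : (1 : ℚ) ≤ N := by exact_mod_cast hN
    have hn' : (1 : ℚ) ≤ n := by exact_mod_cast hn
    calc |formB n N| ≤ ∑ i ∈ range (n + 1), |coefB n i * (N : ℚ) ^ i| := abs_sum_le_sum_abs _ _
      _ ≤ ∑ i ∈ range (n + 1), 4 * n * 2 ^ (7 * n) * (N : ℚ) ^ n := by
        refine sum_le_sum fun i hi => ?_
        have hi' : i ≤ n := Nat.lt_succ_iff.1 (mem_range.1 hi)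
        rw [abs_mul, abs_pow, Nat.abs_cast]
        exact mul_le_mul (abs_coefB_le hi') (pow_le_pow_right₀ hN' hi') (by positivity)
          (by positivity)
      _ = ((n : ℚ) + 1) * (4 * n * 2 ^ (7 * n) * (N : ℚ) ^ n) := by simp
      _ ≤ 10 * (n : ℚ) ^ 3 * 2 ^ (7 * n) * (N : ℚ) ^ n := by
        have h1 : ((n : ℚ) + 1) * (4 * n) ≤ 10 * (n : ℚ) ^ 3 := by
          have hn2 : (n : ℚ) ≤ (n : ℚ) ^ 2 := by nlinarith
          have hn3 : (n : ℚ) ^ 2 ≤ (n : ℚ) ^ 3 := by nlinarith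
          nlinarith
        have h2 : (0 : ℚ) ≤ 2 ^ (7 * n) * (N : ℚ) ^ n := by positivity
        calc ((n : ℚ) + 1) * (4 * n * 2 ^ (7 * n) * (N : ℚ) ^ n)
            = ((n : ℚ) + 1) * (4 * n) * (2 ^ (7 * n) * (N : ℚ) ^ n) := by ring
          _ ≤ 10 * (n : ℚ) ^ 3 * (2 ^ (7 * n) * (N : ℚ) ^ n) :=
              mul_le_mul_of_nonneg_right h1 h2
          _ = _ := by ring
  exact_mod_cast key

/-- `|c_n| ≤ (n+1) · n · (1 + 4n) · 2^{7n} N^n ≤ 10 n³ 2^{7n} N^n` for `n, N ≥ 1`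
(each `1/(i−k)^s ≤ 1`). [cite: DavidHirataKohnoKawashima2020, Thm 2.1] -/
theorem abs_formC_le {n N : ℕ} (hn : 1 ≤ n) (hN : 1 ≤ N) :
    |((formC n N : ℚ) : ℝ)| ≤ 10 * (n : ℝ) ^ 3 * 2 ^ (7 * n) * (N : ℝ) ^ n := by
  have key : |formC n N| ≤ 10 * (n : ℚ) ^ 3 * 2 ^ (7 * n) * (N : ℚ) ^ n := by
    have hN' : (1 : ℚ) ≤ N := by exact_mod_cast hN
    have hn' : (1 : ℚ) ≤ n := by exact_mod_cast hn
    have hterm : ∀ i ∈ range (n + 1), ∀ k ∈ range i,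
        |(N : ℚ) ^ k * ((coefA n i : ℚ) / ((i : ℚ) - k) ^ 2 + coefB n i / ((i : ℚ) - k))| ≤
          (N : ℚ) ^ n * (2 ^ (7 * n) + 4 * n * 2 ^ (7 * n)) := by
      intro i hi k hk
      have hi' : i ≤ n := Nat.lt_succ_iff.1 (mem_range.1 hi)
      have hk' : k < i := mem_range.1 hk
      have hkn : k ≤ n := by omega
      have hd : (1 : ℚ) ≤ (i : ℚ) - k := by
        have : (k : ℚ) + 1 ≤ i := by exact_mod_cast hk'
        linarith
      have hd0 : (0 : ℚ) < (i : ℚ) - k := by linarith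
      have hA : ((coefA n i : ℕ) : ℚ) ≤ 2 ^ (7 * n) := by exact_mod_cast coefA_le hi'
      have h1 : |(coefA n i : ℚ) / ((i : ℚ) - k) ^ 2| ≤ 2 ^ (7 * n) := by
        rw [abs_div, Nat.abs_cast, abs_pow, abs_of_pos hd0]
        exact (div_le_self (by positivity) (one_le_pow₀ hd)).trans hA
      have h2 : |coefB n i / ((i : ℚ) - k)| ≤ 4 * n * 2 ^ (7 * n) := by
        rw [abs_div, abs_of_pos hd0]
        exact (div_le_self (abs_nonneg _) hd).trans (abs_coefB_le hi')
      rw [abs_mul, abs_pow, Nat.abs_cast]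
      exact mul_le_mul (pow_le_pow_right₀ hN' hkn) ((abs_add_le _ _).trans (add_le_add h1 h2))
        (abs_nonneg _) (by positivity)
    have hT0 : (0 : ℚ) ≤ (N : ℚ) ^ n * (2 ^ (7 * n) + 4 * n * 2 ^ (7 * n)) := by positivity
    rw [formC, abs_neg]
    calc |∑ i ∈ range (n + 1), ∑ k ∈ range i,
            (N : ℚ) ^ k * ((coefA n i : ℚ) / ((i : ℚ) - k) ^ 2 + coefB n i / ((i : ℚ) - k))|
        ≤ ∑ i ∈ range (n + 1), |∑ k ∈ range i,
            (N : ℚ) ^ k * ((coefA n i : ℚ) / ((i : ℚ) - k) ^ 2 + coefB n i / ((i : ℚ) - k))| :=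
          abs_sum_le_sum_abs _ _
      _ ≤ ∑ i ∈ range (n + 1), ∑ k ∈ range i,
            |(N : ℚ) ^ k * ((coefA n i : ℚ) / ((i : ℚ) - k) ^ 2 + coefB n i / ((i : ℚ) - k))| :=
          sum_le_sum fun i _ => abs_sum_le_sum_abs _ _
      _ ≤ ∑ i ∈ range (n + 1), ∑ _k ∈ range i,
            (N : ℚ) ^ n * (2 ^ (7 * n) + 4 * n * 2 ^ (7 * n)) :=
          sum_le_sum fun i hi => sum_le_sum fun k hk => hterm i hi k hk
      _ = ∑ i ∈ range (n + 1), (i : ℚ) * ((N : ℚ) ^ n * (2 ^ (7 * n) + 4 * n * 2 ^ (7 * n))) := by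
          simp
      _ ≤ ∑ _i ∈ range (n + 1), (n : ℚ) * ((N : ℚ) ^ n * (2 ^ (7 * n) + 4 * n * 2 ^ (7 * n))) := by
          refine sum_le_sum fun i hi => ?_
          have : (i : ℚ) ≤ n := by exact_mod_cast Nat.lt_succ_iff.1 (mem_range.1 hi)
          exact mul_le_mul_of_nonneg_right this hT0
      _ = ((n : ℚ) + 1) * ((n : ℚ) * ((N : ℚ) ^ n * (2 ^ (7 * n) + 4 * n * 2 ^ (7 * n)))) := by
          simp
      _ ≤ 10 * (n : ℚ) ^ 3 * 2 ^ (7 * n) * (N : ℚ) ^ n := by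
          have h3 : ((n : ℚ) + 1) * n * (1 + 4 * n) ≤ 10 * (n : ℚ) ^ 3 := by
            have hn2 : (n : ℚ) ≤ (n : ℚ) ^ 2 := by nlinarith
            have hn3 : (n : ℚ) ^ 2 ≤ (n : ℚ) ^ 3 := by nlinarith
            nlinarith
          have h2 : (0 : ℚ) ≤ 2 ^ (7 * n) * (N : ℚ) ^ n := by positivity
          calc ((n : ℚ) + 1) * ((n : ℚ) * ((N : ℚ) ^ n * (2 ^ (7 * n) + 4 * n * 2 ^ (7 * n))))
              = ((n : ℚ) + 1) * n * (1 + 4 * n) * (2 ^ (7 * n) * (N : ℚ) ^ n) := by ring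
            _ ≤ 10 * (n : ℚ) ^ 3 * (2 ^ (7 * n) * (N : ℚ) ^ n) :=
                mul_le_mul_of_nonneg_right h3 h2
            _ = _ := by ring
  exact_mod_cast key

/-! ### Integrality -/

/-- A sum of two rationals that are integers is an integer. [folklore] -/
theorem isInt_add {a b : ℚ} (ha : ∃ z : ℤ, a = z) (hb : ∃ z : ℤ, b = z) :
    ∃ z : ℤ, a + b = z := by
  obtain ⟨x, rfl⟩ := ha
  obtain ⟨y, rfl⟩ := hb
  exact ⟨x + y, (Int.cast_add x y).symm⟩

/-- A product of two rationals that are integers is an integer. [folklore] -/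
theorem isInt_mul {a b : ℚ} (ha : ∃ z : ℤ, a = z) (hb : ∃ z : ℤ, b = z) :
    ∃ z : ℤ, a * b = z := by
  obtain ⟨x, rfl⟩ := ha
  obtain ⟨y, rfl⟩ := hb
  exact ⟨x * y, (Int.cast_mul x y).symm⟩

/-- The negative of a rational that is an integer is an integer. [folklore] -/
theorem isInt_neg {a : ℚ} (ha : ∃ z : ℤ, a = z) : ∃ z : ℤ, -a = z := by
  obtain ⟨x, rfl⟩ := ha
  exact ⟨-x, (Int.cast_neg x).symm⟩

/-- A finite sum of rationals that are integers is an integer. [folklore] -/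
theorem isInt_sum {ι : Type*} (s : Finset ι) (f : ι → ℚ) (h : ∀ i ∈ s, ∃ z : ℤ, f i = z) :
    ∃ z : ℤ, ∑ i ∈ s, f i = z := by
  induction s using Finset.cons_induction with
  | empty => exact ⟨0, by simp⟩
  | cons a s ha ih =>
    rw [sum_cons]
    exact isInt_add (h a (mem_cons_self a s)) (ih fun i hi => h i (mem_cons_of_mem hi))

/-- `L / d ∈ ℤ` (as a rational) when the integer `d` divides the natural number `L`
(also in the degenerate case `d = 0`, where `L = 0` and `L/d = 0`). [folklore] -/
theorem isInt_natCast_div {L : ℕ} {d : ℤ} (h : d ∣ (L : ℤ)) :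
    ∃ z : ℤ, (L : ℚ) / (d : ℚ) = z := by
  obtain ⟨k, hk⟩ := h
  rcases eq_or_ne d 0 with rfl | hd
  · exact ⟨0, by simp⟩
  · refine ⟨k, ?_⟩
    rw [div_eq_iff (Int.cast_ne_zero.2 hd)]
    have e : ((L : ℤ) : ℚ) = ((d * k : ℤ) : ℚ) := congrArg (Int.cast (R := ℚ)) hk
    push_cast at e
    rw [e, mul_comm]

/-- `m ∣ lcm(1, …, M)` in `ℤ` for naturals `1 ≤ m ≤ M` (Mathlib's `Finset.dvd_lcm`; the `ℕ` version
is `OddZeta.dvd_lcmUpto` in `Transcendental/OddZetaPartialFractions.lean`). [folklore] -/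
theorem natCast_dvd_lcmUpto {m M : ℕ} (h1 : 1 ≤ m) (hM : m ≤ M) :
    (m : ℤ) ∣ (Nat.lcmUpto M : ℤ) := by
  rw [Int.natCast_dvd_natCast, Nat.lcmUpto]
  exact Finset.dvd_lcm (Finset.mem_Icc.2 ⟨h1, hM⟩)

/-- `(l − i) ∣ lcm(1, …, M)` in `ℤ` for distinct naturals `l, i ≤ M`. [folklore] -/
theorem intCast_sub_dvd_lcmUpto {l i M : ℕ} (hli : l ≠ i) (hl : l ≤ M) (hi : i ≤ M) :
    ((l : ℤ) - i) ∣ (Nat.lcmUpto M : ℤ) := by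
  rw [← Int.natAbs_dvd]
  exact natCast_dvd_lcmUpto (by omega) (by omega)

/-- **Integrality of the harmonic sums**: `lcm(1..3n) · H_{n,i} ∈ ℤ` for `i ≤ n` (all the
denominators `i + j + 1 ≤ 3n` and `0 < |l − i| ≤ n` divide `lcm(1..3n)`).
[cite: DavidHirataKohnoKawashima2020, Thm 2.1] -/
theorem isInt_lcmUpto_mul_harm {n i : ℕ} (hi : i ≤ n) :
    ∃ z : ℤ, (Nat.lcmUpto (3 * n) : ℚ) * harm n i = z := by
  have e : (Nat.lcmUpto (3 * n) : ℚ) * harm n i =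
      (∑ j ∈ range (2 * n), (Nat.lcmUpto (3 * n) : ℚ) / ((i : ℚ) + j + 1)) +
        2 * ∑ l ∈ (range (n + 1)).filter (· ≠ i), (Nat.lcmUpto (3 * n) : ℚ) / ((l : ℚ) - i) := by
    rw [harm, mul_add, mul_sum, mul_left_comm, mul_sum]
    simp only [mul_one_div]
  rw [e]
  refine isInt_add (isInt_sum _ _ fun j hj => ?_)
    (isInt_mul ⟨2, by norm_num⟩ (isInt_sum _ _ fun l hl => ?_))
  · have hj' : j < 2 * n := mem_range.1 hj
    have e1 : (i : ℚ) + j + 1 = (((i + j + 1 : ℕ) : ℤ) : ℚ) := by push_cast; ring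
    rw [e1]
    exact isInt_natCast_div (natCast_dvd_lcmUpto (by omega) (by omega))
  · have hl' : l < n + 1 ∧ l ≠ i := by simpa using hl
    have e2 : (l : ℚ) - i = (((l : ℤ) - i : ℤ) : ℚ) := by push_cast; ring
    rw [e2]
    exact isInt_natCast_div (intCast_sub_dvd_lcmUpto hl'.2 (by omega) (by omega))

/-- `lcm(1..3n) · B_{n,i} ∈ ℤ` for `i ≤ n`. [cite: DavidHirataKohnoKawashima2020, Thm 2.1] -/
theorem isInt_lcmUpto_mul_coefB {n i : ℕ} (hi : i ≤ n) :
    ∃ z : ℤ, (Nat.lcmUpto (3 * n) : ℚ) * coefB n i = z := by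
  obtain ⟨z, hz⟩ := isInt_lcmUpto_mul_harm hi
  refine ⟨-(coefA n i * z), ?_⟩
  rw [coefB, mul_neg, mul_left_comm, hz]
  push_cast
  ring

/-- **Integrality of `b_n`**: `D_n · b_n ∈ ℤ` with `D_n = lcm(1..3n) · lcm(1..n)²`.
[cite: DavidHirataKohnoKawashima2020, Thm 2.1] -/
theorem isInt_denom_mul_formB (n N : ℕ) : ∃ z : ℤ, (denom n : ℚ) * formB n N = z := by
  rw [formB, mul_sum]
  refine isInt_sum _ _ fun i hi => ?_
  have hi' : i ≤ n := Nat.lt_succ_iff.1 (mem_range.1 hi)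
  obtain ⟨z, hz⟩ := isInt_lcmUpto_mul_coefB hi'
  refine ⟨z * (Nat.lcmUpto n : ℤ) ^ 2 * (N : ℤ) ^ i, ?_⟩
  rw [denom]
  push_cast
  rw [← hz]
  ring

/-- **Integrality of `c_n`**: `D_n · c_n ∈ ℤ` with `D_n = lcm(1..3n) · lcm(1..n)²`
(`(i − k)² ∣ lcm(1..n)²` for the `A`-terms, `lcm(1..3n) B_{n,i} ∈ ℤ` and `(i − k) ∣ lcm(1..n)` for
the `B`-terms, `1 ≤ i − k ≤ n`). [cite: DavidHirataKohnoKawashima2020, Thm 2.1] -/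
theorem isInt_denom_mul_formC (n N : ℕ) : ∃ z : ℤ, (denom n : ℚ) * formC n N = z := by
  rw [formC, mul_neg, mul_sum]
  refine isInt_neg (isInt_sum _ _ fun i hi => ?_)
  rw [mul_sum]
  refine isInt_sum _ _ fun k hk => ?_
  have hi' : i ≤ n := Nat.lt_succ_iff.1 (mem_range.1 hi)
  have hk' : k < i := mem_range.1 hk
  obtain ⟨z, hz⟩ := isInt_lcmUpto_mul_coefB hi'
  obtain ⟨w, hw⟩ : ∃ w : ℤ, (Nat.lcmUpto n : ℚ) / ((i : ℚ) - k) = w := by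
    have e : (i : ℚ) - k = (((i : ℤ) - k : ℤ) : ℚ) := by push_cast; ring
    rw [e]
    exact isInt_natCast_div (intCast_sub_dvd_lcmUpto (by omega) hi' (by omega))
  refine ⟨(N : ℤ) ^ k * ((coefA n i : ℤ) * (Nat.lcmUpto (3 * n) : ℤ) * w * w +
    z * (Nat.lcmUpto n : ℤ) * w), ?_⟩
  rw [denom]
  push_cast
  rw [← hz, ← hw]
  generalize (i : ℚ) - k = d
  ring

end DilogPade

end Literature.NumberTheory.DiophantineApproximation
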